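import Mathlib.Data.List.GetD
import Literature.Barriers.ValiantsHypothesis.MonotoneGap
import HarnessLib

/-!
# The monotone gap, proofs (1): the decomposition of a monotone computation into few products

Sibling of `Literature/Barriers/ValiantsHypothesis/MonotoneGap.lean`, first of the files proving
the named fact `JerrumSnir1982_spanningTree` stated there.

**What is proved here** (the structure theorem for monotone circuits, in the fan-in-two model of
the tree). Let `P` be a fan-in-two circuit over the semiring `ℝ≥0` computing a homogeneous
polynomial `g` of degree `d`, and let `1 ≤ m < d`. Then
`g = a₁ b₁ + ⋯ + a_J b_J` with `J ≤ prodCount P` (the number of product gates of `P`) and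
`m < deg aⱼ ≤ 2m` for every `j` (`exists_decomposition`). This is Jerrum–Snir's "conservation of
monomials" (a monotone computation cannot cancel, so every product gate contributes a product
`a · b` coefficientwise below the output, [JerrumSnir1982, §3.1, Lemma 3.1(iii) and Thm. 3.2]) in
the balanced form used by Valiant and by Yehudayoff / Chattopadhyay–Datta–Ghosal–Mukhopadhyay
("`p = Σ_{t ≤ s} a_t b_t` with `n/3 ≤ |I(a_t)| ≤ 2n/3` and `a_t b_t ≤ p`",
[ChattopadhyayDattaGhosalMukhopadhyay2022, Thm. 2.1]); the tree's statement counts product gates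
only (Jerrum–Snir's `⊗`-complexity) and allows arbitrary positive weights on sum gates.

**Proof.** (1) *Zeroing a gate* (`ArithCircuit.zeroAt`, any commutative semiring): replacing gate
`v` by the empty sum changes every gate value `p_w` into `p'_w` with `p_w = p'_w + p_v · h_w` for
some polynomial `h_w` (`linked_gateValues_set`; induction along the fold: sums are linear, and
`Π (xᵢ + p_v yᵢ) = Π xᵢ + p_v · H`), so `P.eval = (P.zeroAt v).eval + p_v · h`; if `v` was a product
gate the number of product gates drops by one. (2) *Descent* (`exists_prodGate_of_lt_totalDegree`):
if some gate value has total degree `> m ≥ 1` then, walking down (a sum or product of `≤ 2` operands of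
degree `≤ m` has degree `≤ 2m`; inputs have degree `≤ 1`), one reaches a product gate whose value
has degree in `(m, 2m]`. (3) Over `ℝ≥0` supports only grow under `+`, so `(P.zeroAt v).eval` is
again homogeneous of degree `d` (or zero) and induction on the number of product gates concludes.

## References

* [JerrumSnir1982] M. Jerrum, M. Snir, *Some exact complexity results for straight-line
  computations over semirings*, J. ACM 29 (1982) 874–897, §3.1 (Lemma 3.1), §3.2 (Thm. 3.2).
* [ChattopadhyayDattaGhosalMukhopadhyay2022] A. Chattopadhyay, R. Datta, U. Ghosal,
  P. Mukhopadhyay, *Monotone complexity of spanning tree polynomial re-visited*, ITCS 2022,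
  §2, Thm. 2.1 (structure theorem, after Yehudayoff, STOC 2019).
* [Valiant1980] L. G. Valiant, *Negation can be exponentially powerful*, TCS 12 (1980), §2.
-/

noncomputable section

namespace Literature.Barriers.ValiantsHypothesis

open Literature.Computability.AlgebraicComplexity MvPolynomial
open ArithCircuit
open scoped NNReal

universe u v

variable {k : Type u} {σ : Type v}

/-! ### Zeroing one gate of a circuit -/

section ZeroAt

/-- The gate computing `0`: the empty sum. [folklore] -/
def zeroGate : Gate k σ := .sum []

/-- The circuit `P` with gate number `v` replaced by the empty sum (computing `0`); all other
gates and the output operand are unchanged (for `v` out of range, `P` itself).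
[cite: JerrumSnir1982, §3.1] -/
def _root_.Literature.Computability.AlgebraicComplexity.ArithCircuit.zeroAt
    (P : ArithCircuit k σ) (v : ℕ) : ArithCircuit k σ where
  gates := P.gates.set v zeroGate
  output := P.output

/-- The empty sum has no operands. [folklore] -/
@[simp] theorem fanIn_zeroGate : (zeroGate : Gate k σ).fanIn = 0 := rfl

/-- The empty sum is not a product gate. [folklore] -/
@[simp] theorem isProdGate_zeroGate : isProdGate (zeroGate : Gate k σ) = false := rfl

/-- Zeroing a gate preserves fan-in two. [folklore] -/
theorem _root_.Literature.Computability.AlgebraicComplexity.ArithCircuit.IsFanInTwo.zeroAt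
    {P : ArithCircuit k σ} (h : P.IsFanInTwo) (v : ℕ) : (P.zeroAt v).IsFanInTwo := by
  intro g hg
  rcases List.mem_or_eq_of_mem_set hg with hg | rfl
  · exact h g hg
  · simp

/-- Zeroing a gate preserves plainness (all sum coefficients `1`). [folklore] -/
theorem IsPlain.zeroAt [One k] {P : ArithCircuit k σ} (h : IsPlain P) (v : ℕ) :
    IsPlain (P.zeroAt v) := by
  intro g hg
  rcases List.mem_or_eq_of_mem_set hg with hg | rfl
  · exact h g hg
  · intro a ha; simp at ha

/-- Zeroing a product gate removes exactly one product gate. [folklore] -/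
theorem prodCount_zeroAt_succ {P : ArithCircuit k σ} {v : ℕ} {args : List (Operand k σ)}
    (hv : P.gates[v]? = some (.prod args)) : prodCount (P.zeroAt v) + 1 = prodCount P := by
  have hlt : v < P.gates.length := (List.getElem?_eq_some_iff.mp hv).1
  have hget : P.gates[v] = Gate.prod args := (List.getElem?_eq_some_iff.mp hv).2
  have hsplit : P.gates = P.gates.take v ++ Gate.prod args :: P.gates.drop (v + 1) := by
    conv_lhs => rw [← List.take_append_drop v P.gates]
    rw [← List.getElem_cons_drop hlt, hget]
  have hset : (P.zeroAt v).gates = P.gates.take v ++ zeroGate :: P.gates.drop (v + 1) := by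
    show P.gates.set v zeroGate = _
    rw [List.set_eq_take_append_cons_drop, if_pos hlt]
  unfold prodCount
  rw [hset]
  conv_rhs => rw [hsplit]
  simp [List.countP_append, isProdGate, zeroGate]
  omega

variable [CommSemiring k]

/-- Two value lists are *linked through `p`* if they have the same length and differ entrywise by
multiples of `p`: `vals[j] = vals'[j] + p · hⱼ`. [cite: JerrumSnir1982, §3.1 (Lemma 3.1(iii))] -/
def Linked (p : MvPolynomial σ k) (vals vals' : List (MvPolynomial σ k)) : Prop :=
  vals.length = vals'.length ∧ ∀ j : ℕ, ∃ h : MvPolynomial σ k, vals.getD j 0 = vals'.getD j 0 + p * h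

/-- Junk references read `0` in both lists. [folklore] -/
private theorem getD_eq_zero_of_le {vals : List (MvPolynomial σ k)} {j : ℕ} (h : vals.length ≤ j) :
    vals.getD j 0 = 0 := by
  rw [List.getD_eq_getElem?_getD, List.getElem?_eq_none_iff.mpr h]
  rfl

/-- Every list is linked to itself (through any `p`). [folklore] -/
theorem Linked.refl (p : MvPolynomial σ k) (vals : List (MvPolynomial σ k)) : Linked p vals vals :=
  ⟨rfl, fun j => ⟨0, by simp⟩⟩

/-- Appending linked entries to linked lists gives linked lists. [folklore] -/
theorem Linked.append_singleton {p : MvPolynomial σ k} {vals vals' : List (MvPolynomial σ k)}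
    (hl : Linked p vals vals') {x x' h : MvPolynomial σ k} (hx : x = x' + p * h) :
    Linked p (vals ++ [x]) (vals' ++ [x']) := by
  refine ⟨by simp [hl.1], fun j => ?_⟩
  rcases Nat.lt_trichotomy j vals.length with hj | hj | hj
  · obtain ⟨h', hh'⟩ := hl.2 j
    refine ⟨h', ?_⟩
    rw [List.getD_append _ _ _ _ hj, List.getD_append _ _ _ _ (hl.1 ▸ hj), hh']
  · refine ⟨h, ?_⟩
    subst hj
    rw [List.getD_append_right _ _ _ _ le_rfl, hl.1, List.getD_append_right _ _ _ _ le_rfl]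
    simpa using hx
  · refine ⟨0, ?_⟩
    rw [getD_eq_zero_of_le (by simp; omega), getD_eq_zero_of_le (by simp [← hl.1]; omega)]
    simp

/-- An operand read against linked lists gives linked values. [cite: JerrumSnir1982, §3.1 (Lemma 3.1(iii))] -/
theorem Linked.operand {p : MvPolynomial σ k} {vals vals' : List (MvPolynomial σ k)}
    (hl : Linked p vals vals') (u : Operand k σ) :
    ∃ h : MvPolynomial σ k, u.eval vals = u.eval vals' + p * h := by
  cases u with
  | var i => exact ⟨0, by simp [Operand.eval]⟩
  | const c => exact ⟨0, by simp [Operand.eval]⟩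
  | gate j =>
    obtain ⟨h, hh⟩ := hl.2 j
    exact ⟨h, by simpa using hh⟩

/-- A gate evaluated against linked lists gives linked values: sums are linear and
`Π (xᵢ + p yᵢ) = Π xᵢ + p · H`. [cite: JerrumSnir1982, §3.1 (Lemma 3.1(iii))] -/
theorem Linked.gate {p : MvPolynomial σ k} {vals vals' : List (MvPolynomial σ k)}
    (hl : Linked p vals vals') (g : Gate k σ) :
    ∃ h : MvPolynomial σ k, g.eval vals = g.eval vals' + p * h := by
  cases g with
  | sum args =>
    induction args with
    | nil => exact ⟨0, by simp [Gate.eval]⟩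
    | cons a args ih =>
      obtain ⟨h₁, h₁eq⟩ := hl.operand a.2
      obtain ⟨h₂, h₂eq⟩ := ih
      refine ⟨a.1 • h₁ + h₂, ?_⟩
      simp only [Gate.eval, List.map_cons, List.sum_cons] at h₂eq ⊢
      rw [h₁eq, h₂eq]
      simp only [MvPolynomial.smul_eq_C_mul]
      ring
  | prod args =>
    induction args with
    | nil => exact ⟨0, by simp [Gate.eval]⟩
    | cons u args ih =>
      obtain ⟨h₁, h₁eq⟩ := hl.operand u
      obtain ⟨h₂, h₂eq⟩ := ih
      simp only [Gate.eval, List.map_cons, List.prod_cons] at h₂eq ⊢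
      refine ⟨u.eval vals' * h₂ + h₁ * (args.map fun u => u.eval vals').prod + p * h₁ * h₂, ?_⟩
      rw [h₁eq, h₂eq]
      ring

/-- **Zeroing a gate changes values by multiples of the old value.** The value lists of `gs` and
of `gs` with gate `v` replaced by the empty sum are linked through the old value `p_v` of gate `v`
(junk `0` if `v` is out of range). [cite: JerrumSnir1982, §3.1 (Lemma 3.1(iii))] -/
theorem linked_gateValues_set (gs : List (Gate k σ)) (v : ℕ) :
    Linked ((gateValues gs).getD v 0) (gateValues gs) (gateValues (gs.set v zeroGate)) := by
  induction gs using List.reverseRecOn with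
  | nil => exact ⟨rfl, fun j => ⟨0, by simp [gateValues]⟩⟩
  | append_singleton gs g ih =>
    have hlen : (gateValues gs).length = gs.length := gateValues_length gs
    rcases Nat.lt_trichotomy v gs.length with hv | hv | hv
    · -- the zeroed gate is among the earlier gates
      rw [List.set_append_left _ _ hv, gateValues_append_singleton, gateValues_append_singleton,
        List.getD_append _ _ _ _ (hlen ▸ hv)]
      obtain ⟨h, hh⟩ := ih.gate g
      exact ih.append_singleton hh
    · -- the zeroed gate is the last one
      subst hv
      rw [List.set_append_right _ _ le_rfl, Nat.sub_self, List.set_cons_zero,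
        gateValues_append_singleton, gateValues_append_singleton,
        List.getD_append_right _ _ _ _ hlen.le, hlen, Nat.sub_self]
      refine (Linked.refl _ _).append_singleton (h := 1) ?_
      simp [zeroGate, Gate.eval]
    · -- out of range: nothing changes
      rw [List.set_eq_of_length_le (by simp; omega)]
      exact Linked.refl _ _

/-- **`P.eval = (P.zeroAt v).eval + p_v · h`** for some polynomial `h`, where `p_v` is the value of
gate `v` in `P`. [cite: JerrumSnir1982, §3.1 (Lemma 3.1(iii))] -/
theorem exists_eval_eq_zeroAt_add (P : ArithCircuit k σ) (v : ℕ) :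
    ∃ h : MvPolynomial σ k, P.eval = (P.zeroAt v).eval + (gateValues P.gates).getD v 0 * h :=
  (linked_gateValues_set P.gates v).operand P.output

end ZeroAt

/-! ### Gate values and prefixes -/

section Values

variable [CommSemiring k]

/-- The first `w` gate values are the values of the first `w` gates. [folklore] -/
theorem gateValues_take (gs : List (Gate k σ)) (w : ℕ) :
    (gateValues gs).take w = gateValues (gs.take w) := by
  induction gs using List.reverseRecOn with
  | nil => simp [gateValues]
  | append_singleton gs g ih =>
    have hlen : (gateValues gs).length = gs.length := gateValues_length gs
    by_cases hw : w ≤ gs.length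
    · rw [gateValues_append_singleton, List.take_append_of_le_length (hlen ▸ hw),
        List.take_append_of_le_length hw, ih]
    · push Not at hw
      rw [List.take_of_length_le (by simp; omega), List.take_of_length_le (by simp; omega)]

/-- The value of gate `w` is its gate evaluated against the values of the earlier gates.
[folklore] -/
theorem getD_gateValues {gs : List (Gate k σ)} {w : ℕ} {g : Gate k σ} (hg : gs[w]? = some g) :
    (gateValues gs).getD w 0 = g.eval ((gateValues gs).take w) := by
  induction gs using List.reverseRecOn with
  | nil => simp at hg
  | append_singleton gs g' ih =>
    have hlen : (gateValues gs).length = gs.length := gateValues_length gs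
    have hlt : w < gs.length + 1 := by
      have := (List.getElem?_eq_some_iff.mp hg).1; simpa using this
    rcases Nat.lt_or_eq_of_le (Nat.lt_succ_iff.mp hlt) with hw | rfl
    · rw [List.getElem?_append_left hw] at hg
      rw [gateValues_append_singleton, List.getD_append _ _ _ _ (hlen ▸ hw),
        List.take_append_of_le_length (hlen ▸ hw.le), ih hg]
    · rw [List.getElem?_append_right le_rfl, Nat.sub_self] at hg
      simp only [List.getElem?_cons_zero, Option.some.injEq] at hg
      subst hg
      rw [gateValues_append_singleton, List.getD_append_right _ _ _ _ hlen.le, hlen, Nat.sub_self,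
        List.take_append_of_le_length hlen.ge, List.take_of_length_le hlen.le]
      simp

/-- Out-of-range gate values are the junk `0`. [folklore] -/
theorem getD_gateValues_eq_zero {gs : List (Gate k σ)} {w : ℕ} (hg : gs[w]? = none) :
    (gateValues gs).getD w 0 = 0 := by
  rw [List.getD_eq_getElem?_getD, List.getElem?_eq_none_iff.mpr]
  · rfl
  · rw [gateValues_length]; exact List.getElem?_eq_none_iff.mp hg

/-- Inside gate `w`, a reference to gate `j` reads the value of gate `j` if `j < w` and junk `0`
otherwise. [folklore] -/
theorem getD_take_gateValues (gs : List (Gate k σ)) (w j : ℕ) :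
    ((gateValues gs).take w).getD j 0 = if j < w then (gateValues gs).getD j 0 else 0 := by
  simp only [List.getD_eq_getElem?_getD, List.getElem?_take]
  split <;> rfl

end Values

/-! ### Descent to a product gate of intermediate degree -/

section Descent

variable [CommSemiring k] [Nontrivial k]

/-- An operand of degree `> m ≥ 1` is a reference to an earlier gate of degree `> m` (inputs have
degree `≤ 1`, junk references degree `0`). [cite: JerrumSnir1982, §3.2] -/
theorem exists_gate_of_lt_totalDegree_operand (vals : List (MvPolynomial σ k)) {m : ℕ}
    (hm : 1 ≤ m) (u : Operand k σ) (hu : m < (u.eval vals).totalDegree) :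
    ∃ j : ℕ, u = .gate j ∧ m < (vals.getD j 0).totalDegree := by
  cases u with
  | var i => simp [Operand.eval] at hu; omega
  | const c => simp [Operand.eval] at hu
  | gate j => exact ⟨j, rfl, by simpa using hu⟩

omit [Nontrivial k] in
/-- A sum or product of at most two polynomials of degree `≤ m'` has degree `≤ 2m'`; contrapositive
form used in the descent: if a fan-in-two gate has value of degree `> 2m'` (product) resp. `> m'`
(sum), some operand has degree `> m'`. Here: the sum case. [folklore] -/
theorem exists_operand_of_lt_totalDegree_sum (vals : List (MvPolynomial σ k)) {m : ℕ}
    (args : List (k × Operand k σ)) (h : m < ((Gate.sum args).eval vals).totalDegree) :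
    ∃ a ∈ args, m < (a.2.eval vals).totalDegree := by
  induction args with
  | nil => simp [Gate.eval] at h
  | cons a args ih =>
    simp only [Gate.eval, List.map_cons, List.sum_cons] at h
    rcases lt_or_ge m (a.2.eval vals).totalDegree with ha | ha
    · exact ⟨a, List.mem_cons_self, ha⟩
    · have hsm : (a.1 • a.2.eval vals).totalDegree ≤ m :=
        le_trans (totalDegree_smul_le a.1 (a.2.eval vals)) ha
      have hadd := totalDegree_add (a.1 • a.2.eval vals)
        ((args.map fun a : k × Operand k σ => a.1 • a.2.eval vals).sum)
      have h2 : m < ((Gate.sum args).eval vals).totalDegree := by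
        simp only [Gate.eval]
        rcases lt_or_ge m
          ((args.map fun a : k × Operand k σ => a.1 • a.2.eval vals).sum.totalDegree) with h2 | h2
        · exact h2
        · exact absurd (lt_of_lt_of_le h (hadd.trans (max_le hsm h2))) (lt_irrefl _)
      obtain ⟨b, hb, hb'⟩ := ih h2
      exact ⟨b, List.mem_cons_of_mem a hb, hb'⟩

omit [Nontrivial k] in
/-- The product case: a product gate of fan-in `≤ 2` with value of degree `> 2m` has an operand
of degree `> m`. [folklore] -/
theorem exists_operand_of_lt_totalDegree_prod (vals : List (MvPolynomial σ k)) {m : ℕ}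
    (args : List (Operand k σ)) (hlen : args.length ≤ 2)
    (h : 2 * m < ((Gate.prod args).eval vals).totalDegree) :
    ∃ u ∈ args, m < (u.eval vals).totalDegree := by
  match args, hlen with
  | [], _ => simp [Gate.eval] at h
  | [u], _ =>
    refine ⟨u, by simp, ?_⟩
    simp only [Gate.eval, List.map_cons, List.map_nil, List.prod_cons, List.prod_nil, mul_one] at h
    omega
  | [u₁, u₂], _ =>
    simp only [Gate.eval, List.map_cons, List.map_nil, List.prod_cons, List.prod_nil, mul_one] at h
    have h' := lt_of_lt_of_le h (totalDegree_mul _ _)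
    rcases lt_or_ge m (u₁.eval vals).totalDegree with h₁ | h₁
    · exact ⟨u₁, by simp, h₁⟩
    · exact ⟨u₂, by simp, by omega⟩
  | _ :: _ :: _ :: _, hlen => simp at hlen

/-- **Descent.** In a fan-in-two circuit, below any gate whose value has degree `> m ≥ 1` there is
a product gate whose value has degree in `(m, 2m]`. [cite: JerrumSnir1982, §3.3 (proof of Thm. 3.4)] -/
theorem exists_prodGate_of_lt_totalDegree (gs : List (Gate k σ)) (h2 : ∀ g ∈ gs, g.fanIn ≤ 2)
    {m : ℕ} (hm : 1 ≤ m) (w : ℕ) (hw : m < ((gateValues gs).getD w 0).totalDegree) :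
    ∃ (v : ℕ) (args : List (Operand k σ)), v ≤ w ∧ gs[v]? = some (.prod args) ∧
      m < ((gateValues gs).getD v 0).totalDegree ∧
      ((gateValues gs).getD v 0).totalDegree ≤ 2 * m := by
  induction w using Nat.strong_induction_on with
  | _ w ih =>
    -- the gate at `w` exists (junk values have degree `0`)
    rcases hg : gs[w]? with _ | g
    · rw [getD_gateValues_eq_zero hg] at hw; simp at hw
    have hval := getD_gateValues hg
    set vals := (gateValues gs).take w with hvals
    -- an operand of gate `w` of degree `> m` leads, by induction, to the product gate
    have hop : ∀ u : Operand k σ, m < (u.eval vals).totalDegree →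
        ∃ (v : ℕ) (args : List (Operand k σ)), v ≤ w ∧ gs[v]? = some (.prod args) ∧
          m < ((gateValues gs).getD v 0).totalDegree ∧
          ((gateValues gs).getD v 0).totalDegree ≤ 2 * m := by
      intro u hu
      obtain ⟨j, rfl, hj⟩ := exists_gate_of_lt_totalDegree_operand vals hm u hu
      rw [hvals, getD_take_gateValues] at hj
      split_ifs at hj with hjw
      · obtain ⟨v, args, hvj, hv⟩ := ih j hjw hj
        exact ⟨v, args, hvj.trans hjw.le, hv⟩
      · simp at hj
    have hfan : g.fanIn ≤ 2 := h2 g (List.mem_of_getElem? hg)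
    cases g with
    | sum args =>
      rw [hval] at hw
      obtain ⟨a, -, ha⟩ := exists_operand_of_lt_totalDegree_sum vals args hw
      exact hop a.2 ha
    | prod args =>
      by_cases hle : ((gateValues gs).getD w 0).totalDegree ≤ 2 * m
      · exact ⟨w, args, le_rfl, hg, hw, hle⟩
      · push Not at hle
        rw [hval] at hle
        obtain ⟨u, -, hu⟩ := exists_operand_of_lt_totalDegree_prod vals args hfan hle
        exact hop u hu

end Descent

/-! ### The decomposition over `ℝ≥0` -/

section Decomposition

/-- Over `ℝ≥0` nothing cancels: if `g = g' + q` then `supp g' ⊆ supp g`. [cite: JerrumSnir1982, §3.1 (Lemma 3.1)] -/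
theorem support_subset_of_eq_add {g g' q : MvPolynomial σ ℝ≥0} (h : g = g' + q) :
    g'.support ⊆ g.support := by
  intro x hx
  rw [mem_support_iff] at hx ⊢
  rw [h, coeff_add]
  exact ne_of_gt (lt_of_lt_of_le (pos_iff_ne_zero.mpr hx) le_self_add)

/-- Homogeneity passes to coefficientwise smaller polynomials over `ℝ≥0`. [folklore] -/
theorem isHomogeneous_of_eq_add {g g' q : MvPolynomial σ ℝ≥0} {d : ℕ} (hg : g.IsHomogeneous d)
    (h : g = g' + q) : g'.IsHomogeneous d := by
  intro x hx
  exact hg (mem_support_iff.mp (support_subset_of_eq_add h (mem_support_iff.mpr hx)))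

/-- **The decomposition theorem (Jerrum–Snir §3 / Valiant / Yehudayoff, in the tree's model).**
A fan-in-two circuit `P` over `ℝ≥0` computing a homogeneous polynomial of degree `d > m ≥ 1`
writes its output as a sum of at most `prodCount P` products `a · b` with `m < deg a ≤ 2m`.
[cite: JerrumSnir1982, §3 (Lemma 3.1(iii), Thm. 3.2)] [cite: ChattopadhyayDattaGhosalMukhopadhyay2022, Thm. 2.1] -/
theorem exists_decomposition {m d : ℕ} (hm : 1 ≤ m) (hmd : m < d) :
    ∀ (n : ℕ) (P : ArithCircuit ℝ≥0 σ), prodCount P ≤ n → P.IsFanInTwo →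
      P.eval.IsHomogeneous d →
      ∃ L : List (MvPolynomial σ ℝ≥0 × MvPolynomial σ ℝ≥0),
        L.length ≤ prodCount P ∧ P.eval = (L.map fun ab => ab.1 * ab.2).sum ∧
        ∀ ab ∈ L, m < ab.1.totalDegree ∧ ab.1.totalDegree ≤ 2 * m := by
  intro n
  induction n with
  | zero =>
    intro P hn h2 hhom
    -- no product gate: the output must vanish
    by_cases h0 : P.eval = 0
    · exact ⟨[], by simp, by simp [h0], by simp⟩
    · exfalso
      have hdeg : m < P.eval.totalDegree := by rw [hhom.totalDegree h0]; exact hmd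
      obtain ⟨j, hj, hjdeg⟩ :=
        exists_gate_of_lt_totalDegree_operand (gateValues P.gates) hm P.output hdeg
      obtain ⟨v, args, -, hv, -, -⟩ :=
        exists_prodGate_of_lt_totalDegree P.gates h2 hm j hjdeg
      have := prodCount_zeroAt_succ hv
      omega
  | succ n ih =>
    intro P hn h2 hhom
    by_cases h0 : P.eval = 0
    · exact ⟨[], by simp, by simp [h0], by simp⟩
    have hdeg : m < P.eval.totalDegree := by rw [hhom.totalDegree h0]; exact hmd
    obtain ⟨j, hj, hjdeg⟩ :=
      exists_gate_of_lt_totalDegree_operand (gateValues P.gates) hm P.output hdeg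
    obtain ⟨v, args, -, hv, hvlo, hvhi⟩ :=
      exists_prodGate_of_lt_totalDegree P.gates h2 hm j hjdeg
    have hcount := prodCount_zeroAt_succ hv
    obtain ⟨h, hh⟩ := exists_eval_eq_zeroAt_add P v
    obtain ⟨L, hL, hLsum, hLdeg⟩ :=
      ih (P.zeroAt v) (by omega) (h2.zeroAt v) (isHomogeneous_of_eq_add hhom hh)
    refine ⟨((gateValues P.gates).getD v 0, h) :: L, ?_, ?_, ?_⟩
    · simp only [List.length_cons]; omega
    · simp only [List.map_cons, List.sum_cons]
      rw [hh, hLsum, add_comm]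
    · intro ab hab
      simp only [List.mem_cons] at hab
      rcases hab with rfl | hab
      · exact ⟨hvlo, hvhi⟩
      · exact hLdeg ab hab

/-- **Corollary for monotone computations of a homogeneous polynomial** (the form consumed by the
lower bound): the computed polynomial `f`, homogeneous of degree `d > m ≥ 1`, is a sum of at most
`prodCount P` products `a · b`, `m < deg a ≤ 2m`. [cite: JerrumSnir1982, §3 (Cor. 3.5)] -/
theorem IsMonotoneComputation.exists_decomposition {P : ArithCircuit ℝ≥0 σ}
    {f : MvPolynomial σ ℝ≥0} (hP : IsMonotoneComputation P f) {m d : ℕ} (hm : 1 ≤ m)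
    (hmd : m < d) (hf : f.IsHomogeneous d) :
    ∃ L : List (MvPolynomial σ ℝ≥0 × MvPolynomial σ ℝ≥0),
      L.length ≤ prodCount P ∧ f = (L.map fun ab => ab.1 * ab.2).sum ∧
      ∀ ab ∈ L, m < ab.1.totalDegree ∧ ab.1.totalDegree ≤ 2 * m := by
  obtain ⟨h2, -, hcomp⟩ := hP
  have heval : P.eval = f := hcomp
  subst heval
  exact _root_.Literature.Barriers.ValiantsHypothesis.exists_decomposition hm hmd _ P le_rfl h2 hf

end Decomposition

end Literature.Barriers.ValiantsHypothesis
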